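import Summits.ValiantsHypothesis.ValiantsHypothesis.Theses.FeketeSOS
import Summits.ValiantsHypothesis.ValiantsHypothesis.Theorems.FeketeNoSparseSplit.Negative.StubHypotheses
import Literature.NumberTheory.LFunctions.FeketePolynomial

/-!
# `FeketeNoSparseSplit` (crux stmt-ValiantsHypothesis-3997): the char-`p` multiplicity lever has CEILING `(p-1)/2`,
and one sign flip destroys the certificate (cdisprove cycle 3, part 1 of 3)

Negative-side boundary facts for the line `Cruxes/FeketeNoSparseSplit/Lines/cyclic-valuation-dichotomy.lean`
(refuter-cdisprove-stmt-ValiantsHypothesis-3997-g3-0; BarrierNotes-ideator2 §B1 "local-at-p ceiling ≈ p/2" made a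
theorem), PROVED, no new facts.  The line certifies `|supp A| + |supp B| ≥ ord₁ Ā + ord₁ B̄ + 2 = ord₁ F̄_p + 2`
with `ord₁ F̄_p = (p-1)/2` (Euler's criterion).  Companions: `LegendreExtremiser.lean` (uniqueness of the extremiser
`±χ_p`, distance law) and `LeverExactOrder.lean` (the ceiling is attained: `ord₁ F̄_p = (p-1)/2` exactly, i.e. the
line's stub 2; plus stubs 1 and 3).

* `not_pow_dvd_of_sum_sq_ne_zero` — for ANY coefficient sequence `ε` over a field of characteristic `p` with
  `Σ_{m<p} ε(m)² ≠ 0`, `(X-1)^k ∤ E := Σ_{m<p} ε(m) X^m` as soon as `2k ≥ p`.  Proof: if `(X-1)^k ∣ E` then also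
  `(X-1)^k ∣ E† := reflect (p-1) E`, so `X^p - 1 = (X-1)^p ∣ E·E†`; but `deg (E·E†) ≤ 2p-2` forces the cofactor to
  have degree `≤ p-2`, so the coefficient of `X^{p-1}` in `E·E†` vanishes — and it equals `Σ_m ε(m)²`.
* `rootMultiplicity_one_le_half(_of_unimodular)` — hence `ord₁ E ≤ (p-1)/2` for every such `ε`; in particular for
  every `ε` with `ε(0) = 0`, `ε(m) = ±1` on `[1, p-1]` (`Σ ε² = p-1 = -1`), and for `F̄_p` itself
  (`rootMultiplicity_one_fekete_le_half`).  So the multiplicity lever can NEVER certify more than `(p+3)/2` for a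
  `±1`-coefficient target on `[1, p-1]`: the line's constant `1/2` is the ceiling of the whole method.
* `rootMultiplicity_one_flip_eq_zero` — FRAGILITY: flipping ONE sign of `F_p` (at any `1 ≤ m₀ < p`) gives `ord₁ = 0`
  (value at `1` is `∓2 ≠ 0`), so the certificate collapses from `(p+3)/2` to the trivial `2`, while the TRUE minimum
  support-sum of complex splittings is robust — exhaustively (cycle 3, pure python, Durand–Kerner, all `2^{p-3}` root
  subsets per flip): `p = 11`: all 10 one-flip perturbations have minimum `11` (256/256 splittings full), `p = 13`: all
  12 have minimum `13`, `p = 17`: all 16 have minimum `17` (16384/16384 full) — the flip even removes the `(X∓1)`-peel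
  savings of `F_p` itself (`9`, `10`, `14`); `p = 7`: flips at `m₀ = 2,3,4,5` give `5` via the accidental factor `1 + X³`
  (`X - X² - X³ + X⁴ - X⁵ - X⁶ = (X + X⁴)(1 - X - X²)`).  Lesson for the sibling cruxes (`s₀ ≥ 3`, where this lever is
  void): the truth is sign-robust, the only known certificate is not (quantified by the distance law in
  `LegendreExtremiser.lean`).
-/

namespace Summit.ValiantsHypothesis.Theorems.FeketeNoSparseSplit.Negative

open Polynomial Finset

section Ceiling

variable {K : Type*} [Field K]

/-- `reflect 1 (X - 1) = 1 - X`. -/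
theorem reflect_one_X_sub_C_one : reflect 1 (X - C (1 : K)) = 1 - X := by
  have h : reflect 1 ((X : K[X]) ^ 1) = X ^ revAt 1 1 := reflect_monomial 1 1
  rw [pow_one, revAt_le (le_refl 1), Nat.sub_self, pow_zero] at h
  rw [reflect_sub, reflect_C, C_1, one_mul, pow_one, h]

/-- `reflect k ((X - 1)^k) = (1 - X)^k`. -/
theorem reflect_X_sub_C_one_pow (k : ℕ) : reflect k ((X - C (1 : K)) ^ k) = (1 - X) ^ k := by
  induction k with
  | zero => rw [pow_zero, pow_zero, ← C_1, reflect_C, C_1, one_mul, pow_zero]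
  | succ k ih =>
    have hdeg : ((X - C (1 : K)) ^ k).natDegree ≤ k := by
      rw [natDegree_pow, natDegree_X_sub_C, mul_one]
    rw [pow_succ, reflect_mul _ _ hdeg (natDegree_X_sub_C (1 : K)).le, ih, reflect_one_X_sub_C_one, pow_succ]

/-- Coefficients of an explicit sum of monomials `Σ_{i<p} ε(i) X^i`. -/
theorem coeff_sum_C_mul_X_pow (ε : ℕ → K) (p m : ℕ) :
    (∑ i ∈ range p, C (ε i) * X ^ i).coeff m = if m < p then ε m else 0 := by
  simp only [finsetSum_coeff, coeff_C_mul_X_pow]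
  rw [Finset.sum_ite_eq (range p) m]
  simp [Finset.mem_range]

/-- `Σ_{i<p} ε(i) X^i` has degree `≤ p - 1`. -/
theorem natDegree_sum_C_mul_X_pow_le (ε : ℕ → K) (p : ℕ) :
    (∑ i ∈ range p, C (ε i) * X ^ i).natDegree ≤ p - 1 := by
  refine natDegree_sum_le_of_forall_le _ _ fun i hi => ?_
  rw [Finset.mem_range] at hi
  exact (natDegree_C_mul_X_pow_le _ _).trans (by omega)

/-- If `Σ_{i<p} ε(i)² ≠ 0` then `Σ_{i<p} ε(i) X^i ≠ 0`. -/
theorem sum_C_mul_X_pow_ne_zero (ε : ℕ → K) (p : ℕ) (hε : (∑ m ∈ range p, ε m ^ 2) ≠ 0) :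
    (∑ i ∈ range p, C (ε i) * X ^ i) ≠ 0 := by
  intro h
  apply hε
  refine Finset.sum_eq_zero fun m hm => ?_
  rw [Finset.mem_range] at hm
  have hc := coeff_sum_C_mul_X_pow ε p m
  rw [h, coeff_zero, if_pos hm] at hc
  rw [← hc, sq, zero_mul]

/-- **The lever's ceiling (general form).**  Over a field `K` of characteristic `p`, if `Σ_{m<p} ε(m)² ≠ 0` then
`(X - 1)^k ∤ Σ_{m<p} ε(m) X^m` whenever `p ≤ 2k`.  (Reflect, multiply, reduce modulo `X^p - 1 = (X-1)^p`, read
off the coefficient of `X^{p-1}`, which is `Σ ε(m)²`.) [folklore] -/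
theorem not_pow_dvd_of_sum_sq_ne_zero (p : ℕ) [Fact p.Prime] [CharP K p] (ε : ℕ → K)
    (hε : (∑ m ∈ range p, ε m ^ 2) ≠ 0) {k : ℕ} (hk : p ≤ 2 * k) :
    ¬ (X - C (1 : K)) ^ k ∣ ∑ m ∈ range p, C (ε m) * X ^ m := by
  have hprime : p.Prime := Fact.out
  have hp1 : 1 ≤ p := hprime.one_lt.le
  set E : K[X] := ∑ m ∈ range p, C (ε m) * X ^ m with hE
  rintro ⟨G, hG⟩
  have hcoeff : ∀ m, E.coeff m = if m < p then ε m else 0 := coeff_sum_C_mul_X_pow ε p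
  have hE0 : E ≠ 0 := sum_C_mul_X_pow_ne_zero ε p hε
  have hdegE : E.natDegree ≤ p - 1 := natDegree_sum_C_mul_X_pow_le ε p
  have hXk0 : (X - C (1 : K)) ^ k ≠ 0 := pow_ne_zero _ (X_sub_C_ne_zero 1)
  have hdegXk : ((X - C (1 : K)) ^ k).natDegree = k := by
    rw [natDegree_pow, natDegree_X_sub_C, mul_one]
  have hG0 : G ≠ 0 := by
    rintro rfl
    rw [mul_zero] at hG
    exact hE0 hG
  have hdegG : k + G.natDegree ≤ p - 1 := by
    have h := natDegree_mul hXk0 hG0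
    rw [← hG, hdegXk] at h
    omega
  -- the reflected polynomial `E† = reflect (p-1) E` is again divisible by `(X-1)^k`
  set E' : K[X] := reflect (p - 1) E with hE'
  have hsplit : p - 1 = k + (p - 1 - k) := by omega
  have hrefl : E' = (1 - X) ^ k * reflect (p - 1 - k) G := by
    rw [hE', hG, show reflect (p - 1) ((X - C (1 : K)) ^ k * G) =
        reflect (k + (p - 1 - k)) ((X - C (1 : K)) ^ k * G) by rw [← hsplit],
      reflect_mul _ _ hdegXk.le (by omega), reflect_X_sub_C_one_pow]
  have hdvd' : (X - C (1 : K)) ^ k ∣ E' := by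
    rw [hrefl]
    refine Dvd.dvd.mul_right ⟨C (-1) ^ k, ?_⟩ _
    rw [← mul_pow]
    congr 1
    rw [map_neg, C_1]
    ring
  -- hence `(X-1)^p = X^p - 1` divides `E·E†`
  have h2k : (X - C (1 : K)) ^ (k + k) ∣ E * E' := by
    rw [pow_add]
    exact mul_dvd_mul ⟨G, hG⟩ hdvd'
  have hp_dvd : (X - C (1 : K)) ^ p ∣ E * E' := (pow_dvd_pow _ (by omega)).trans h2k
  rw [X_sub_C_one_pow_char K p] at hp_dvd
  obtain ⟨g, hg⟩ := hp_dvd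
  -- the coefficient of `X^{p-1}` in `E·E†` is `Σ ε(m)²`
  have hlhs : (E * E').coeff (p - 1) = ∑ m ∈ range p, ε m ^ 2 := by
    rw [coeff_mul, Finset.Nat.sum_antidiagonal_eq_sum_range_succ_mk, Nat.succ_eq_add_one,
      Nat.sub_add_cancel hp1]
    refine Finset.sum_congr rfl fun m hm => ?_
    rw [Finset.mem_range] at hm
    dsimp only
    rw [hE', coeff_reflect, revAt_le (by omega : p - 1 - m ≤ p - 1),
      show p - 1 - (p - 1 - m) = m by omega, hcoeff m, if_pos hm, sq]
  -- but in `(X^p - 1)·g` with `deg g ≤ p - 2` it vanishes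
  have hdegE' : E'.natDegree ≤ p - 1 := natDegree_reflect_le.trans (max_le le_rfl hdegE)
  have hdegEE' : (E * E').natDegree ≤ (p - 1) + (p - 1) := natDegree_mul_le.trans (add_le_add hdegE hdegE')
  have hXp0 : (X ^ p - 1 : K[X]) ≠ 0 := X_pow_sub_one_ne_zero' K p
  have hg0 : g ≠ 0 := by
    rintro rfl
    rw [mul_zero] at hg
    rw [hg, coeff_zero] at hlhs
    exact hε hlhs.symm
  have hdegg : g.natDegree + 1 ≤ p - 1 := by
    have h1 := natDegree_mul hXp0 hg0
    rw [← hg] at h1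
    have h2 : (X ^ p - 1 : K[X]).natDegree = p := by
      rw [← C_1, natDegree_X_pow_sub_C]
    rw [h2] at h1
    omega
  have hrhs : ((X ^ p - 1 : K[X]) * g).coeff (p - 1) = 0 := by
    rw [sub_mul, one_mul, coeff_sub, coeff_X_pow_mul', if_neg (by omega), zero_sub, neg_eq_zero]
    exact coeff_eq_zero_of_natDegree_lt (by omega)
  rw [hg, hrhs] at hlhs
  exact hε hlhs.symm

/-- **The lever's ceiling**: `ord₁ (Σ_{m<p} ε(m) X^m) ≤ (p-1)/2` whenever `Σ_{m<p} ε(m)² ≠ 0` (char `K = p`). -/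
theorem rootMultiplicity_one_le_half (p : ℕ) [Fact p.Prime] [CharP K p] (ε : ℕ → K)
    (hε : (∑ m ∈ range p, ε m ^ 2) ≠ 0) :
    rootMultiplicity (1 : K) (∑ m ∈ range p, C (ε m) * X ^ m) ≤ (p - 1) / 2 := by
  rw [rootMultiplicity_le_iff (sum_C_mul_X_pow_ne_zero ε p hε)]
  exact not_pow_dvd_of_sum_sq_ne_zero p ε hε (by omega)

/-- For `ε(0) = 0` and `ε(m)² = 1` on `[1, p-1]`: `Σ_{m<p} ε(m)² = -1` in characteristic `p`. -/
theorem sum_sq_eq_neg_one (p : ℕ) [Fact p.Prime] [CharP K p] (ε : ℕ → K) (h0 : ε 0 = 0)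
    (hε : ∀ m, 1 ≤ m → m < p → ε m ^ 2 = 1) : ∑ m ∈ range p, ε m ^ 2 = -1 := by
  have hprime : p.Prime := Fact.out
  obtain ⟨n, hn⟩ : ∃ n, p = n + 1 := ⟨p - 1, by have := hprime.one_lt; omega⟩
  have hsum : ∑ m ∈ range p, ε m ^ 2 = ∑ i ∈ range n, (1 : K) := by
    rw [hn, Finset.sum_range_succ', h0, sq, zero_mul, add_zero]
    exact Finset.sum_congr rfl fun i hi => hε (i + 1) (by omega) (by rw [Finset.mem_range] at hi; omega)
  rw [hsum, Finset.sum_const, Finset.card_range, nsmul_eq_mul, mul_one]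
  have hp0 : ((p : ℕ) : K) = 0 := CharP.cast_eq_zero K p
  rw [hn, Nat.cast_succ] at hp0
  exact eq_neg_of_add_eq_zero_left hp0

/-- **Ceiling for unimodular targets**: for every `ε` with `ε(0) = 0`, `ε(m) = ±1` (`1 ≤ m < p`) — every conceivable
`±1` "symbol" on `[1, p-1]`, Legendre or not — the multiplicity of `1` as a root of `Σ_{m<p} ε(m) X^m` over a field
of characteristic `p` is at most `(p-1)/2`.  The char-`p` multiplicity lever therefore certifies at most
`(p-1)/2 + 2 = (p+3)/2`: the line's constant is the METHOD's ceiling (BarrierNotes-ideator2 §B1 as a theorem). -/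
theorem rootMultiplicity_one_le_half_of_unimodular (p : ℕ) [Fact p.Prime] [CharP K p] (ε : ℕ → K)
    (h0 : ε 0 = 0) (hε : ∀ m, 1 ≤ m → m < p → ε m = 1 ∨ ε m = -1) :
    rootMultiplicity (1 : K) (∑ m ∈ range p, C (ε m) * X ^ m) ≤ (p - 1) / 2 := by
  refine rootMultiplicity_one_le_half p ε ?_
  rw [sum_sq_eq_neg_one p ε h0 fun m h1 h2 => ?_]
  · exact neg_ne_zero.mpr one_ne_zero
  · rcases hε m h1 h2 with h | h <;> rw [h] <;> ring

/-- **The Legendre target sits exactly at the ceiling** (`≤` half of the line's `stub_feketeModPOrder`, for free):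
`ord₁ F̄_p ≤ (p-1)/2` over every field of characteristic `p`. -/
theorem rootMultiplicity_one_fekete_le_half (p : ℕ) [Fact p.Prime] [CharP K p] :
    rootMultiplicity (1 : K) (∑ m ∈ Finset.range p, C ((legendreSym p m : ℤ) : K) * X ^ m) ≤ (p - 1) / 2 := by
  refine rootMultiplicity_one_le_half_of_unimodular p (fun m => ((legendreSym p m : ℤ) : K)) ?_ ?_
  · simp [legendreSym.at_zero]
  · intro m h1 h2
    have hne : ((((m : ℕ) : ℤ)) : ZMod p) ≠ 0 := by
      rw [Int.cast_natCast, Ne, ZMod.natCast_eq_zero_iff]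
      exact Nat.not_dvd_of_pos_of_lt (by omega) h2
    rcases legendreSym.eq_one_or_neg_one p hne with h | h
    · left; simp [h]
    · right; simp [h]

/-- **Fragility of the certificate**: flip ONE sign of `F_p` — at any position `1 ≤ m₀ < p` — and the reduction
modulo `p` no longer vanishes at `1` at all (`ord₁ = 0`: the value at `1` is `Σ χ_p - 2χ_p(m₀) = ∓2 ≠ 0`, `p` odd).
The lever's bound drops from `(p+3)/2` to the trivial `2`; the true minimum support-sum does not drop (exhaustive
numerics in the module docstring: it rises to `p` at `p = 11, 13, 17`). -/
theorem rootMultiplicity_one_flip_eq_zero (p : ℕ) [Fact p.Prime] [CharP K p] (hp : p ≠ 2)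
    (m₀ : ℕ) (hm₀ : 1 ≤ m₀) (hm₀p : m₀ < p) :
    rootMultiplicity (1 : K) (∑ m ∈ Finset.range p, C ((legendreSym p m : ℤ) : K) * X ^ m
      - C (2 * ((legendreSym p m₀ : ℤ) : K)) * X ^ m₀) = 0 := by
  have hprime : p.Prime := Fact.out
  rw [rootMultiplicity_eq_zero_iff]
  intro hroot
  exfalso
  have hev : (∑ m ∈ Finset.range p, C ((legendreSym p m : ℤ) : K) * X ^ m).eval 1 = 0 := by
    rw [eval_finsetSum]
    simp only [eval_mul, eval_C, eval_pow, eval_X, one_pow, mul_one]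
    rw [← Int.cast_sum, Literature.NumberTheory.LFunctions.sum_range_legendreSym p hp, Int.cast_zero]
  rw [IsRoot, eval_sub, hev, eval_mul, eval_C, eval_pow, eval_X, one_pow, mul_one, zero_sub, neg_eq_zero,
    mul_eq_zero] at hroot
  have h2 : (2 : K) ≠ 0 := by
    intro h
    have h' : ((2 : ℕ) : K) = 0 := by exact_mod_cast h
    rw [CharP.cast_eq_zero_iff K p] at h'
    have := (Nat.prime_dvd_prime_iff_eq hprime Nat.prime_two).mp h'
    exact hp this
  have hne : ((((m₀ : ℕ) : ℤ)) : ZMod p) ≠ 0 := by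
    rw [Int.cast_natCast, Ne, ZMod.natCast_eq_zero_iff]
    exact Nat.not_dvd_of_pos_of_lt (by omega) hm₀p
  rcases hroot with h | h
  · exact h2 h
  · rcases legendreSym.eq_one_or_neg_one p hne with h1 | h1
    · rw [h1, Int.cast_one] at h; exact one_ne_zero h
    · rw [h1, Int.cast_neg, Int.cast_one, neg_eq_zero] at h; exact one_ne_zero h


end Ceiling

end Summit.ValiantsHypothesis.Theorems.FeketeNoSparseSplit.Negative
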